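import Mathlib
import HarnessLib
import HarnessLib.Audit
import Summits.Langlands.Statement
import Summits.Langlands.Langlands.Theses.PadicReachabilityCarving
import HarnessLib.Audit.Status.Attr

/-!
Route: RefinementCarving

# Route RefinementCarving — the irregular reachable p-adic core RI
(PadicReachabilityCarving.ReachableIrregularCoreAtP, stmt-Langlands-26900: «for K solvably
reachable, n ≥ 2 and π cuspidal L-algebraic with NO regular L-algebraic infinity type, the
irreducible ℓ-adic Satake-avatar ρ of π is de Rham at every v ∣ ℓ (DR-half) and, when ρ is a.e.
unramified and de Rham at ℓ, D_pst(ρ|K_v) carries a Weil–Deligne representation whose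
complexification has the Weil-group traces of rec_v(π_v) (S_p-half)») carved along the EXACT SCOPE
OF THE ONLY ENGINE THAT REACHES IRREGULAR WEIGHT AT p

It suffices to show X := REF ∧ UNREF, the two cells of RI cut by a dial that is LOCAL AT v and read
off π_v alone:
  DIAL(π, v) := «for every local component πv of π at v, every local Langlands datum L and every
Frobenius-semisimple S in the class L.recGL n [πv]: S.N = 0 and S.ρ is diagonal in some basis with
PAIRWISE DISTINCT characters χ_i of the Weil group of K_v» — i.e. π_v is a REGULAR PRINCIPAL SERIES
(Boxer–Pilloni's «p-distinguished» hypothesis: rec(π_v) a sum of n distinct characters, N = 0;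
ramification allowed).
- REF `RefinedIrregularCoreAtP` (crux 2): both halves of RI under DIAL. This is the cell where
p-adic families built from COHERENT cohomology have an accumulation property and crystalline periods
can be found «one at a time» (Kisin): PRINT on the polarised weakly-regular odd sector over TR/CM
(Boxer–Pilloni arXiv:2110.10251 Thm 23 = Thm 351 (4): ρ|K_v potentially crystalline AND ι
WD(ρ|K_v)^{F-ss} = rec(π_v) — both halves at once; Jorza 2012 Thm 3.1 for GSp4 low weight; the GSp4
irregular case again in Boxer–Pilloni's Montreal notes Thm 1.41 (2)); IDEA-NEEDED on the
non-polarised / Hodge–Tate-multiplicity ≥ 3 sub-sector, declared inside the item.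
- UNREF `UnrefinedIrregularCoreAtP` (residual 3, DECLARED RESIDUAL): both halves of RI under ¬DIAL —
π_v special / Steinberg-type (N ≠ 0), supercuspidal support, or a principal series with a repeated
character. Here the period strategy has nothing to interpolate (Jorza: «distinct Satake parameters
is structural … not even Hodge–Tate without it»; Newton 2015 §1.1: the Steinberg case «seems to
require a new idea») and the catalogued barrier MonodromyNotClosedUnderPadicLimits (scope (a):
p-adic limits of de Rham representations need not be de Rham) bites head-on.
Lean: `closes (hRef : RefinedIrregularCoreAtP) (hUnref : UnrefinedIrregularCoreAtP) :
PadicReachabilityCarving.ReachableIrregularCoreAtP` (by_cases on DIAL pointwise; kernel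
`ri_iff_cells : RI ↔ REF ∧ UNREF` in the node, standard axioms). Both cells are S-implied
(`Cert.ref_of_langlands`, `Cert.unref_of_langlands`), each is STRICTLY WEAKER than RI by the probes
of record (REF ↛ RI, UNREF ↛ RI, REF ↮ UNREF, neither ↛ T, Langlands), and the partition is closed
under algebraic twists by the kernel lemma `regularSplitParameter_twist_iff`; its two orbit leaks
(solvable base change can collapse distinct χ_i; automorphic induction lands in UNREF) are declared
penumbra of the residual, instrumentable by transport (Arthur–Clozel Thms 4.2/5.1/6.2), exactly as
cleared for the g19 parent (CRITIC-LEDGER row 230).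

REFINES route-Langlands-PadicReachabilityCarving:ReachableIrregularCoreAtP (edge split, depth 1;
chain route-Langlands-PadicReachabilityCarving › route-Langlands-RefinementCarving) — the deciding
theorem of this CHILD route concludes the parent piece
`Summit.Langlands.Langlands.Theses.PadicReachabilityCarving.ReachableIrregularCoreAtP` BY NAME
(imported from Summits.Langlands.Langlands.Theses.PadicReachabilityCarving); closing this route
proves that piece of the parent, never the summit Statement (D-0170).

Rationale: WHY THIS LINE. Lens 6 (barrier-complement carving) on the one (A)-side leaf of the p-adic
reachability partition that is tagged INSTRUMENTABLE/IDEA-NEEDED and has never been cut: RI =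
stmt-Langlands-26900 (bus collision check ≤ STATUS L1238: untargeted; the g19→g20 chain went down UR
instead, and critic rule m4 (row 245) forbids further dials below LIND/ATR/LAR/UR — RI is a
different item under a different barrier family). For irregular π every Betti/patching method is
dead (NonRegularWeightBarrier; TaylorWilesNumericalCoincidence), so the ONLY print that reaches
local–global compatibility AT p for irregular weight is p-adic interpolation of crystalline periods
along finite-slope families realised in COHERENT cohomology (Kisin 2003; Jorza 2012
[corpus:paper:doi-10-4310-mrl-2012-v19-n5-a2 p.5 Thm 3.1]; Boxer–Pilloni higher Coleman theory
[corpus:paper:arxiv-2110.10251 p.10 Thm 23 (4), p.121 Thm 351 (4)], [galaxy:pdf:4808790131885196400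
p.21 Thm 1.41 (2)]) — and that engine has a sharp, LOCAL scope printed by its authors: π_v a regular
principal series («p-distinguished … rec(π_v ⊗ |det|^{(1-n)/2}) is a sum of n distinct characters,
so that we can prove that ρ is potentially crystalline by finding its periods one at a time», p.10
L41). The dial IS that scope, typed on the LLC parameter (so it is invariant under the choice of πv
in its class and of the datum L up to the canonical one, and twist-closed by a kernel lemma), which
rule f1 (row 230: residual dials must be local at v, not field-type) demands for a local-at-v
target. Imported from another area: nothing beyond p-adic Hodge theory / eigenvarieties; no physical
analogy.
RANKED CRUXES. (2) RefinedIrregularCoreAtP — hardest informative step: vend Boxer–Pilloni Thm 351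
(4) as a named Literature fact (shape of
`galoisRep_GL2_totallyReal_holomorphic_localGlobal_awayFromEll`; the tree's
HilbertPartialWeightOneGaloisRep lists it under «What is NOT here») and close the polarised
weakly-regular odd sector over the TR/CM floor, first for n = 2 over totally real K (partial weight
one, birth stub `stub_ref_rankTwo`); the non-polarised / HT-multiplicity ≥ 3 remainder of REF is
IDEA-NEEDED (no limit-of-discrete-series ⇒ no coherent realisation ⇒ no family with accumulation).
(3) UnrefinedIrregularCoreAtP — DECLARED RESIDUAL (tribunal_fit.residual): IDEA-NEEDED · BARRIER
MonodromyNotClosedUnderPadicLimits scope (a); no engine; penumbra (BC-collapses of REF members,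
AI-images of lower rank, CM-dihedral inductions from AB) instrumentable by transport only.
KILL CRITERIA. (i) a refuter shows REF → RI or UNREF → RI cheaply after a tree move (probesA rc ≠ 0:
the dial became vacuous on cuspidal π — e.g. a landed theorem that cuspidal local components at v ∣
ℓ of irregular L-algebraic π are never / always regular principal series); (ii) the mechanism critic
reduces the dial to the g17 ClassicalityWeightSplit / SenNullAlignment levers on the SAME item (they
act on (B)-host 25026 resp. on n = 2 TR aligned places — different items, but a ruling of «same
lever» retires this node); (iii) a counterexample to REF on its print sector would refute
Boxer–Pilloni (4) — not expected; (iv) Langlands itself refuted (both cells are S-implied).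
NOT DECOMPOSED YET. REF's internal split polarised-weakly-regular-odd ∣ rest is described, not typed
(no `IsWeaklyRegular` / oddness / polarisation-without-datum API in the tree; `IsConjSelfDualAE`
needs a conjugation datum) — the birth skeleton splits REF by RANK (n = 2 ∣ n ≥ 3) instead, which is
typed and genuine; UNREF is not split (residual). The S_p-half of REF on the print sector needs the
vendored fact to speak the tree's `IsWeilDeligneOf` / `frobSemisimpleWDSetoid` language (dictionary
= the one written for AHTW2026WeilDeligneAtP).
CHEAPEST FALSIFIER. `lean check probesA.lean` (34 fail_if_success probes, rc 0 of record) — one farm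
call; then the in-print check that Boxer–Pilloni (4) really covers BOTH halves (it does:
«potentially crystalline» = DR-half up to the pst/cris gap, «ι WD^{F-ss} ≅ rec» ⇒ equal Weil traces
= S_p-half) for partial weight one Hilbert forms with π_v regular principal series (p.121 L20–25).

Novelty: Searches RUN (2026-08-30/31; corpus fts+vec AND galaxy, labelled). `lit search --hybrid
"local-global compatibility at p irregular weight partial weight one crystalline periods
eigenvariety"` → [corpus:paper:arxiv-2110.10251 p.10 Thm 23, p.11 Rem 24, p.120–121 Thm 350/351]
Boxer–Pilloni (the engine and its printed scope «π_v regular principal series»),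
[corpus:paper:doi-10-4310-mrl-2012-v19-n5-a2 p.2 Thm B, p.5 Thm 2.1/3.1, p.6 (Kisin Cor 5.15)] Jorza
(GSp4 low weight: crystalline at p iff-direction under distinct Satake parameters; «structural»),
[corpus:paper:arxiv-2607.11763 p.5] AHTW (regular π over CM only — the RB cell, not RI); `lit
vsearch "p-adic limits of de Rham representations need not be de Rham Steinberg local global
compatibility"` → Newton 2015 §1.1 / Moy–Specter Rem 1.1 (cited in the tree barrier file
MonodromyNotClosedUnderPadicLimits :58–61) ; galaxy: `lit galaxy search "higher Coleman" --star pdf`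
→ [galaxy:pdf:4808790131885196400 p.21 Thm 1.41 (2), p.22 Rem 1.42] Boxer–Pilloni Montreal notes
(irregular GSp4: «If π_p has an unramified regular principal series then … crystalline at p and
ι⁻¹WD(ρ_π|G_{Q_p})^{F-ss} corresponds to π_p»; «novelty … analytic interpolation using the
eigenvariety, rather than congruences»); `lit galaxy search "eigenvariety|eigenvarieties" --star
pdf` → [galaxy:pdf:2716389994365116420] Bergdall–Hansen (p-refined Hilbert forms; cohomological
only), [galaxy:pdf:-879919448991286500] Birkbeck–Heuer–Williams (overconvergent HMF; no Galo  [refs: paper:arxiv-2110.10251, paper:doi-10-4310-mrl-2012-v19-n5-a2, paper:arxiv-2607.11763]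

Barriers (technique_class: p-adic-interpolation; crystalline-periods; eigenvarieties): - technique_class: p-adic interpolation of crystalline periods along finite-slope families in
coherent cohomology (Kisin; eigenvarieties / higher Coleman theory); p-adic Hodge theory (D_pst →
WD); local Langlands for GL_n (parameter-side dial)
- Literature.Barriers.Langlands.MonodromyNotClosedUnderPadicLimits: REF sits OUTSIDE scope (a) by
construction — on the dial N = 0 is the PREDICTED monodromy and the n distinct characters give n
crystalline periods to interpolate, so nothing has to survive a limit that the barrier says does not
survive; UNREF sits INSIDE head-on (declared residual: N ≠ 0 / supercuspidal / collapsed parameters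
are exactly where «p-adic limits of de Rham representations need not be de Rham» and N is invisible
to traces).
- Literature.Barriers.Langlands.NonRegularWeightBarrier: BOTH cells sit inside its statement
(irregular π: no Betti realisation, no automorphy lifting) — the route does not beat it, it ROUTES
AROUND it: the engine for REF uses COHERENT cohomology of Shimura varieties (partial weight one /
limits of discrete series), which the barrier's technique class (singular cohomology + patching)
does not quantify over [corpus:paper:arxiv-2110.10251 p.10 L21: «realizing in the coherent
cohomology of Shimura varieties, but not in the Betti cohomology»].
- Literature.Barriers.Langlands.NonRegularWeightBarrierNarrow: same placement as
NonRegularWeightBarrier above (one record, two decls) — BOTH cells sit inside its statement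
(irregular π: no Betti realis

sub-problem: Langlands · status: draft · opened planner-decomp-langlands-writer-1-g5-0 2026-08-31T00:34:00Z · rev 0 · ledger route-Langlands-RefinementCarving
GENERATED by the gate from the ledger (D-0016/17). Provers cite these decls: `theorem foo : Summit.Langlands.Langlands.Theses.RefinementCarving.<Decl> := …` in Summits/Langlands/Langlands/Theorems/<Name>.lean.
-/

namespace Summit.Langlands.Langlands.Theses.RefinementCarving

open scoped BigOperators Topology Manifold Classical MeasureTheory ProbabilityTheory Matrix InnerProductSpace ComplexConjugate ContinuousMap
open Filter Set Function TopologicalSpace MeasureTheory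

attribute [summit_statement] _root_.Langlands
attribute [summit_statement] _root_.Summit.Langlands.Langlands.Theses.PadicReachabilityCarving.ReachableIrregularCoreAtP

/-- item stmt-Langlands-27212 · crux · leaf ATTACKABLE · rank 2 · open · by planner
why it might fail: S-implied (`Cert.ref_of_langlands`): only CLOSING can fail — the engine is printed for polarised weakly-regular odd π over TR/CM only (coherent realisation; BP Rem 24: conditional on Mok); non-polarised irregular π (GL2/CM, GLn n ≥ 3) and HT-multiplicity ≥ 3 have no family with accumulation.
sources: BoxerPilloni2021 = arXiv:2110.10251 Thm 23 (4) [corpus:paper:arxiv-2110.10251 p.10 L23–41: «π_v a regular principal series ⇒ ρ|G_{L_v} potentially crystalline and ιWD^{F-ss} ≅ rec(π_v ⊗ |det|^{(1-n)/2})»; «p-distinguished … n distinct characters … periods one at a time»], BoxerPilloni2021 Thm 351 (4) [corpus:paper:arxiv-2110.10251 p.121 L20: «i.e. the Jacquet module (π_v)_U is a direct sum of n! distinct characters of T(L_v)»]; Rem 24 [p.11: conditional on Mok / unitary-group input], Jorza2012 = doi:10.4310/MRL.2012.v19.n5.a2 Thm B / Thm 3.1 [corpus:paper:doi-10-4310-mrl-2012-v19-n5-a2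 p.2, p.5: GSp4 low weight, «distinct Satake parameters … structural»; p.6: Kisin Cor 5.15], BoxerPilloniMontreal = [galaxy:pdf:4808790131885196400 p.21 Thm 1.41 (2), p.22 Rem 1.42] (irregular GSp4/Q: unramified regular principal series ⇒ crystalline + WD^{F-ss} matches), Kisin2003 = doi:10.1007/s00222-003-0293-8 (Overconvergent modular forms and the Fontaine–Mazur conjecture: interpolation of crystalline periods), tree: Literature/NumberTheory/Automorphic/HilbertPartialWeightOneGaloisRep.lean («What is NOT here»: local–global compatibility at v ∣ ℓ, Boxer–Pilloni (4), not vendored); Literature/NumberTheory/Automorphic/AHTW2026WeilDeligneAtP.lean (the dictionary shape for an at-p WD fact)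
[crux · REF · WEAKER (RI restricted to the dial; probes of record: REF ↛ RI / T / Langlands / UNREF
cheaply, bc7 CLEAN ×2) · S-implied (`Cert.ref_of_langlands`) · leaf ATTACKABLE on the PRINT SECTOR =
polarised (essentially (conjugate) self-dual) weakly-regular odd π over the TR/CM floor of the
reachable K, π_v regular principal series: Boxer–Pilloni Thm 351 (4) gives BOTH halves (potentially
crystalline ⇒ de Rham; ιWD^{F-ss} ≅ rec(π_v) ⇒ equal Weil traces against the canonical LLC of `Rec`)
once vendored as a named fact + the L-normalisation dictionary; first rung n = 2 over totally real K
= partial weight one Hilbert eigenforms (birth stub `stub_ref_rankTwo`); reachable non-floor K: move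
π to the floor by solvable base change (the dial can collapse under BC — such members are booked in
UNREF's penumbra, declared); IDEA-NEEDED sub-sector: non-polarised irregular π and Hodge–Tate
multiplicity ≥ 3 (no limit of discrete series ⇒ no coherent realisation). Dial typed on the LLC
PARAMETER (any datum L, any πv in the class): canonical, and twist-closed by the node kernel
`regularSplitParameter_twist_iff`.] -/
@[route_item "route-Langlands-RefinementCarving", crux (bottleneck := work) (source := "ledger D-0171 leaf tag ATTACKABLE on stmt-Langlands-27212, 2026-09-01")]
def RefinedIrregularCoreAtP : Prop :=
  (∀ (K : Type) [Field K] [NumberField K] (n : ℕ) (hcpt : Literature.NumberTheory.Automorphic.isCompact_glFiniteIntegralLevel n K), 0 < n → ∀ (π : Literature.NumberTheory.Automorphic.CuspidalAutomorphicRepData n K hcpt), π.1.IsLAlgebraic → Summit.Langlands.Langlands.Theorems.InsolubleInduction.SolvablyReachable K → 2 ≤ n → ¬ (∃ T : Literature.NumberTheory.Automorphic.InfinityType K n, π.1.HasInfinityType T ∧ T.IsLAlgebraic ∧ T.IsRegular) → ∀ (ℓ : ℕ) [Fact ℓ.Prime] (ι : PadicAlgCl ℓ ≃+* ℂ) (ρ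 : Literature.NumberTheory.GaloisRepresentations.FramedGaloisRep K (PadicAlgCl ℓ) n), ρ.toGaloisRep.IsIrreducible → (∀ᶠ v : IsDedekindDomain.HeightOneSpectrum (NumberField.RingOfIntegers K) in cofinite, SatakeFrobCompatibleAt ι π.1 ρ v) → ∀ (v : IsDedekindDomain.HeightOneSpectrum (NumberField.RingOfIntegers K)) (hv : ((ℓ : ℕ) : NumberField.RingOfIntegers K) ∈ v.asIdeal), (∀ (πv : Literature.NumberTheory.Automorphic.SmoothIrrep (Matrix.GeneralLinearGroup (Fin n) (v.adicCompletion K))), π.1.HasLocalComponentAt v πv.ρ → ∀ (L : Literature.NumberTheory.Automorphic.LocalLanglandsDatum (v.adicCompletion K)) (S : Literature.NumberTheory.GaloisRepresentations.WeilDeligneRep (v.adicCompletion K) ℂ (Fin n → ℂ)) (hS : S.IsFrobSemisimple), Quotient.mk (Literature.NumberTheory.Automorphic.frobSemisimpleWDSetoid (v.adicCompletion K) n) ⟨S, hS⟩ = L.recGL n (Literature.NumberTheory.Automorphic.IrrClass.mk πv) → (S.N = 0 ∧ ∃ (b : Module.Basis (Fin n) ℂ (Fin n → ℂ)) (χ :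 Fin n → Literature.NumberTheory.GaloisRepresentations.WeilGroup (v.adicCompletion K) → ℂ), Function.Injective χ ∧ ∀ (i : Fin n) (w : Literature.NumberTheory.GaloisRepresentations.WeilGroup (v.adicCompletion K)), S.ρ w (b i) = χ i w • b i)) → (Literature.NumberTheory.PAdicHodge.fontainePstAdicCompletion v ℓ hv).IsDeRhamFramed (ρ.toLocal v)) ∧ (∀ (K : Type) [Field K] [NumberField K] (Rec : ReciprocityData K) (n : ℕ) (hcpt : Literature.NumberTheory.Automorphic.isCompact_glFiniteIntegralLevel n K), 0 < n → ∀ (π : Literature.NumberTheory.Automorphic.CuspidalAutomorphicRepData n K hcpt), π.1.IsLAlgebraic → Summit.Langlands.Langlands.Theorems.InsolubleInduction.SolvablyReachable K → 2 ≤ n → ¬ (∃ T : Literature.NumberTheory.Automorphic.InfinityType K n, π.1.HasInfinityType T ∧ T.IsLAlgebraic ∧ T.IsRegular) → ∀ (ℓ : ℕ) [Fact ℓ.Prime] (ι : PadicAlgCl ℓ ≃+* ℂ) (ρ : Literature.NumberTheory.GaloisRepresentations.FramedGaloisRep K (PadicAlgCl ℓ) n), ρ.toGaloisRep.IsIrreducible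 → ((∀ᶠ v : IsDedekindDomain.HeightOneSpectrum (NumberField.RingOfIntegers K) in Filter.cofinite, ρ.IsUnramifiedAt v) ∧ ∀ (v : IsDedekindDomain.HeightOneSpectrum (NumberField.RingOfIntegers K)) (hv : ((ℓ : ℕ) : NumberField.RingOfIntegers K) ∈ v.asIdeal), (Literature.NumberTheory.PAdicHodge.fontainePstAdicCompletion v ℓ hv).IsDeRhamFramed (ρ.toLocal v)) → (∀ᶠ v : IsDedekindDomain.HeightOneSpectrum (NumberField.RingOfIntegers K) in Filter.cofinite, SatakeFrobCompatibleAt ι π.1 ρ v) → ∀ (v : IsDedekindDomain.HeightOneSpectrum (NumberField.RingOfIntegers K)) (hv : ((ℓ : ℕ) : NumberField.RingOfIntegers K) ∈ v.asIdeal), (∀ (πv : Literature.NumberTheory.Automorphic.SmoothIrrep (Matrix.GeneralLinearGroup (Fin n) (v.adicCompletion K))), π.1.HasLocalComponentAt v πv.ρ → ∀ (L : Literature.NumberTheory.Automorphic.LocalLanglandsDatum (v.adicCompletion K)) (S : Literature.NumberTheory.GaloisRepresentations.WeilDeligneRep (v.adicCompletion K) ℂ (Fin n → ℂ)) (hS :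 S.IsFrobSemisimple), Quotient.mk (Literature.NumberTheory.Automorphic.frobSemisimpleWDSetoid (v.adicCompletion K) n) ⟨S, hS⟩ = L.recGL n (Literature.NumberTheory.Automorphic.IrrClass.mk πv) → (S.N = 0 ∧ ∃ (b : Module.Basis (Fin n) ℂ (Fin n → ℂ)) (χ : Fin n → Literature.NumberTheory.GaloisRepresentations.WeilGroup (v.adicCompletion K) → ℂ), Function.Injective χ ∧ ∀ (i : Fin n) (w : Literature.NumberTheory.GaloisRepresentations.WeilGroup (v.adicCompletion K)), S.ρ w (b i) = χ i w • b i)) → ∃ (πv : Literature.NumberTheory.Automorphic.SmoothIrrep (Matrix.GeneralLinearGroup (Fin n) (v.adicCompletion K))) (r : Literature.NumberTheory.GaloisRepresentations.WeilDeligneRep (v.adicCompletion K) (PadicAlgCl ℓ) (Fin n → PadicAlgCl ℓ)) (rℂ : Literature.NumberTheory.GaloisRepresentations.WeilDeligneRep (v.adicCompletion K) ℂ (Fin n → ℂ)), π.1.HasLocalComponentAt v πv.ρ ∧ (Rec.pst ℓ v hv).IsWeilDeligneOf (ρ.toLocal v) r ∧ r.IsTransportAlong (ι : PadicAlgCl ℓ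 →+* ℂ) rℂ ∧ ∀ (S : Literature.NumberTheory.GaloisRepresentations.WeilDeligneRep (v.adicCompletion K) ℂ (Fin n → ℂ)) (hS : S.IsFrobSemisimple), Quotient.mk (Literature.NumberTheory.Automorphic.frobSemisimpleWDSetoid (v.adicCompletion K) n) ⟨S, hS⟩ = (Rec.llc v).recGL n (Literature.NumberTheory.Automorphic.IrrClass.mk πv) → ∀ w : Literature.NumberTheory.GaloisRepresentations.WeilGroup (v.adicCompletion K), LinearMap.trace ℂ (Fin n → ℂ) (rℂ.ρ w) = LinearMap.trace ℂ (Fin n → ℂ) (S.ρ w))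

/-- item stmt-Langlands-27213 · crux · RESIDUAL (gen 0; summit-strength until shown otherwise, D-0170) · leaf BARRIER [Literature.Barriers.Langlands.MonodromyNotClosedUnderPadicLimits] · rank 3 · open · by planner
why it might fail: Declared residual: off the dial there are no n distinct crystalline periods to interpolate and N ≠ 0 is invisible to p-adic limits (MonodromyNotClosedUnderPadicLimits (a); Newton §1.1; Jorza p.2); only the penumbra (BC-collapses, AI-images, CM-dihedral) is instrumentable, by transport.
sources: Newton2015 = doi:10.1112/S0010437X14007994 §1.1 (p-adic limits of de Rham reps need not be de Rham; Steinberg-at-p local–global compatibility «seems to require a new idea»), cited in tree Literature/Barriers/Langlands/MonodromyNotClosedUnderPadicLimits.lean :58–61, MoySpecter2015 Rem 1.1 (same obstruction at v ∣ p), ibid., Jorza2012 [corpus:paper:doi-10-4310-mrl-2012-v19-n5-a2 p.2: «the condition … distinct Satake parameters is structural: without it one cannot show that ρ_{π,p}|G_{Q_p} is even Hodge–Tate»], ArthurClozelAMS120 Ch. 3 Thms 4.2 / 5.1 / 6.2 (cyclic base change and automorphic induction — the transport that books the declared penumbra), BoxerPilloni2021 [corpus:paper:arxiv-2110.10251 p.121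 L25: «π_v is a constituent of a principal series» needed even to place π on the eigenvariety]
[residual · UNREF · DECLARED RESIDUAL · WEAKER (RI restricted to ¬dial; probes: UNREF ↛ RI / T /
Langlands / REF cheaply, bc7 CLEAN ×2) · S-implied (`Cert.unref_of_langlands`) · leaf IDEA-NEEDED ·
BARRIER Literature.Barriers.Langlands.MonodromyNotClosedUnderPadicLimits scope (a) head-on: π_v with
N ≠ 0 (special / generalised Steinberg segments), supercuspidal support, or principal series with a
repeated character — no crystalline-period interpolation, no closed condition known to replace it
(Newton 2015 §1.1 «new idea»; Moy–Specter Rem 1.1; Jorza p.2). Declared PENUMBRA (orbit leaks of the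
partition under {solvable BC, AI}; twists do NOT leak): (α) solvable base changes of REF members
whose distinct χ_i collapse over L_w, (β) automorphic inductions from rank n/d over cyclic L/K
(parameter = induced, hence in UNREF whenever irreducible-induced), (γ) CM-dihedral / AI from the
abelian cell AB — all instrumentable by transport (Arthur–Clozel 4.2/5.1/6.2 + de Rham/WD
restriction along K_v → L_w), none by a native engine; the dark bulk (supercuspidal at v ∣ ℓ of a
primitive irregular π; genuine Steinberg) is the catalogued open problem.] -/
@[route_item "route-Langlands-RefinementCarving", crux]
def UnrefinedIrregularCoreAtP : Prop :=
  (∀ (K : Type) [Field K] [NumberField K] (n : ℕ) (hcpt : Literature.NumberTheory.Automorphic.isCompact_glFiniteIntegralLevel n K), 0 < n → ∀ (π : Literature.NumberTheory.Automorphic.CuspidalAutomorphicRepData n K hcpt), π.1.IsLAlgebraic → Summit.Langlands.Langlands.Theorems.InsolubleInduction.SolvablyReachable K → 2 ≤ n → ¬ (∃ T : Literature.NumberTheory.Automorphic.InfinityType K n, π.1.HasInfinityType T ∧ T.IsLAlgebraic ∧ T.IsRegular) → ∀ (ℓ : ℕ) [Fact ℓ.Prime] (ι : PadicAlgCl ℓ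 ≃+* ℂ) (ρ : Literature.NumberTheory.GaloisRepresentations.FramedGaloisRep K (PadicAlgCl ℓ) n), ρ.toGaloisRep.IsIrreducible → (∀ᶠ v : IsDedekindDomain.HeightOneSpectrum (NumberField.RingOfIntegers K) in cofinite, SatakeFrobCompatibleAt ι π.1 ρ v) → ∀ (v : IsDedekindDomain.HeightOneSpectrum (NumberField.RingOfIntegers K)) (hv : ((ℓ : ℕ) : NumberField.RingOfIntegers K) ∈ v.asIdeal), ¬ (∀ (πv : Literature.NumberTheory.Automorphic.SmoothIrrep (Matrix.GeneralLinearGroup (Fin n) (v.adicCompletion K))), π.1.HasLocalComponentAt v πv.ρ → ∀ (L : Literature.NumberTheory.Automorphic.LocalLanglandsDatum (v.adicCompletion K)) (S : Literature.NumberTheory.GaloisRepresentations.WeilDeligneRep (v.adicCompletion K) ℂ (Fin n → ℂ)) (hS : S.IsFrobSemisimple), Quotient.mk (Literature.NumberTheory.Automorphic.frobSemisimpleWDSetoid (v.adicCompletion K) n) ⟨S, hS⟩ = L.recGL n (Literature.NumberTheory.Automorphic.IrrClass.mk πv) → (S.N = 0 ∧ ∃ (b : Module.Basis (Fin n) ℂ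 (Fin n → ℂ)) (χ : Fin n → Literature.NumberTheory.GaloisRepresentations.WeilGroup (v.adicCompletion K) → ℂ), Function.Injective χ ∧ ∀ (i : Fin n) (w : Literature.NumberTheory.GaloisRepresentations.WeilGroup (v.adicCompletion K)), S.ρ w (b i) = χ i w • b i)) → (Literature.NumberTheory.PAdicHodge.fontainePstAdicCompletion v ℓ hv).IsDeRhamFramed (ρ.toLocal v)) ∧ (∀ (K : Type) [Field K] [NumberField K] (Rec : ReciprocityData K) (n : ℕ) (hcpt : Literature.NumberTheory.Automorphic.isCompact_glFiniteIntegralLevel n K), 0 < n → ∀ (π : Literature.NumberTheory.Automorphic.CuspidalAutomorphicRepData n K hcpt), π.1.IsLAlgebraic → Summit.Langlands.Langlands.Theorems.InsolubleInduction.SolvablyReachable K → 2 ≤ n → ¬ (∃ T : Literature.NumberTheory.Automorphic.InfinityType K n, π.1.HasInfinityType T ∧ T.IsLAlgebraic ∧ T.IsRegular) → ∀ (ℓ : ℕ) [Fact ℓ.Prime] (ι : PadicAlgCl ℓ ≃+* ℂ) (ρ : Literature.NumberTheory.GaloisRepresentations.FramedGaloisRep K (PadicAlgCl ℓ) n), ρ.toGaloisRep.IsIrreducible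 → ((∀ᶠ v : IsDedekindDomain.HeightOneSpectrum (NumberField.RingOfIntegers K) in Filter.cofinite, ρ.IsUnramifiedAt v) ∧ ∀ (v : IsDedekindDomain.HeightOneSpectrum (NumberField.RingOfIntegers K)) (hv : ((ℓ : ℕ) : NumberField.RingOfIntegers K) ∈ v.asIdeal), (Literature.NumberTheory.PAdicHodge.fontainePstAdicCompletion v ℓ hv).IsDeRhamFramed (ρ.toLocal v)) → (∀ᶠ v : IsDedekindDomain.HeightOneSpectrum (NumberField.RingOfIntegers K) in Filter.cofinite, SatakeFrobCompatibleAt ι π.1 ρ v) → ∀ (v : IsDedekindDomain.HeightOneSpectrum (NumberField.RingOfIntegers K)) (hv : ((ℓ : ℕ) : NumberField.RingOfIntegers K) ∈ v.asIdeal), ¬ (∀ (πv : Literature.NumberTheory.Automorphic.SmoothIrrep (Matrix.GeneralLinearGroup (Fin n) (v.adicCompletion K))), π.1.HasLocalComponentAt v πv.ρ → ∀ (L : Literature.NumberTheory.Automorphic.LocalLanglandsDatum (v.adicCompletion K)) (S : Literature.NumberTheory.GaloisRepresentations.WeilDeligneRep (v.adicCompletion K) ℂ (Fin n → ℂ)) (hS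 : S.IsFrobSemisimple), Quotient.mk (Literature.NumberTheory.Automorphic.frobSemisimpleWDSetoid (v.adicCompletion K) n) ⟨S, hS⟩ = L.recGL n (Literature.NumberTheory.Automorphic.IrrClass.mk πv) → (S.N = 0 ∧ ∃ (b : Module.Basis (Fin n) ℂ (Fin n → ℂ)) (χ : Fin n → Literature.NumberTheory.GaloisRepresentations.WeilGroup (v.adicCompletion K) → ℂ), Function.Injective χ ∧ ∀ (i : Fin n) (w : Literature.NumberTheory.GaloisRepresentations.WeilGroup (v.adicCompletion K)), S.ρ w (b i) = χ i w • b i)) → ∃ (πv : Literature.NumberTheory.Automorphic.SmoothIrrep (Matrix.GeneralLinearGroup (Fin n) (v.adicCompletion K))) (r : Literature.NumberTheory.GaloisRepresentations.WeilDeligneRep (v.adicCompletion K) (PadicAlgCl ℓ) (Fin n → PadicAlgCl ℓ)) (rℂ : Literature.NumberTheory.GaloisRepresentations.WeilDeligneRep (v.adicCompletion K) ℂ (Fin n → ℂ)), π.1.HasLocalComponentAt v πv.ρ ∧ (Rec.pst ℓ v hv).IsWeilDeligneOf (ρ.toLocal v) r ∧ r.IsTransportAlong (ι : PadicAlgCl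 ℓ →+* ℂ) rℂ ∧ ∀ (S : Literature.NumberTheory.GaloisRepresentations.WeilDeligneRep (v.adicCompletion K) ℂ (Fin n → ℂ)) (hS : S.IsFrobSemisimple), Quotient.mk (Literature.NumberTheory.Automorphic.frobSemisimpleWDSetoid (v.adicCompletion K) n) ⟨S, hS⟩ = (Rec.llc v).recGL n (Literature.NumberTheory.Automorphic.IrrClass.mk πv) → ∀ w : Literature.NumberTheory.GaloisRepresentations.WeilGroup (v.adicCompletion K), LinearMap.trace ℂ (Fin n → ℂ) (rℂ.ρ w) = LinearMap.trace ℂ (Fin n → ℂ) (S.ρ w))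

/-- item stmt-Langlands-27214 · assembly · rank 1 · closed · proved by Summit.Langlands.Langlands.Theorems.refinementCarving_assembly_proof (prover) · by planner
[assembly] RefinedIrregularCoreAtP → UnrefinedIrregularCoreAtP →
PadicReachabilityCarving.ReachableIrregularCoreAtP (pointwise excluded middle on the dial; node
kernel `ri_iff_cells`). -/
@[route_item "route-Langlands-RefinementCarving"]
def Assembly : Prop :=
  RefinedIrregularCoreAtP → UnrefinedIrregularCoreAtP → Summit.Langlands.Langlands.Theses.PadicReachabilityCarving.ReachableIrregularCoreAtP

-- `Assembly` holds: proved by `Summit.Langlands.Langlands.Theorems.refinementCarving_assembly_proof` (its module imports this route file, so no `_holds` link can be stated here).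

/-! D-0027 §2.1 — DECIDING THEOREM (planner-authored via `route open/edit --closes-file`; by planner-decomp-langlands-writer-1-g5-0 2026-08-31T00:34:00Z):
its hypotheses are this route's items and its conclusion the registered leaf `Summit.Langlands.Langlands.Theses.PadicReachabilityCarving.ReachableIrregularCoreAtP` (rung None, D-0061) (glue_lint), and it elaborates with this file. -/

/- Deciding theorem of the CHILD ROUTE `RefinementCarving` (`--refines route-Langlands-PadicReachabilityCarving:ReachableIrregularCoreAtP`): the irregular reachable core
   RI = PadicReachabilityCarving.ReachableIrregularCoreAtP (stmt-Langlands-26900) BY NAME from its two cells, by pointwise excluded middle on the dial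
   (= node kernel `closes_child` / `ri_iff_cells.2` VERBATIM up to the namespace; axioms propext, Classical.choice, Quot.sound). -/
@[closes "route-Langlands-RefinementCarving"] theorem closes (hRef : RefinedIrregularCoreAtP) (hUnref : UnrefinedIrregularCoreAtP) :
    Summit.Langlands.Langlands.Theses.PadicReachabilityCarving.ReachableIrregularCoreAtP :=
  ⟨fun K _ _ n hcpt hn π hL hR h2 hI ℓ _ ι ρ hirr hsat v hv =>
      (Classical.em _).elim (hRef.1 K n hcpt hn π hL hR h2 hI ℓ ι ρ hirr hsat v hv) (hUnref.1 K n hcpt hn π hL hR h2 hI ℓ ι ρ hirr hsat v hv),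
    fun K _ _ Rec n hcpt hn π hL hR h2 hI ℓ _ ι ρ hirr hgeo hsat v hv =>
      (Classical.em _).elim (hRef.2 K Rec n hcpt hn π hL hR h2 hI ℓ ι ρ hirr hgeo hsat v hv) (hUnref.2 K Rec n hcpt hn π hL hR h2 hI ℓ ι ρ hirr hgeo hsat v hv)⟩

end Summit.Langlands.Langlands.Theses.RefinementCarving
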